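import Mathlib.Analysis.Calculus.BumpFunction.FiniteDimension
import Mathlib.Analysis.Calculus.ContDiff.WithLp
import Mathlib.Analysis.SpecialFunctions.Trigonometric.ArctanDeriv
import Literature.Geometry.Lorentzian.Basic
import Literature.Geometry.Lorentzian.Genericity
import HarnessLib

/-!
# Stub `stub_diagonalSurgery` of the line `capture-exports-censorship-diagonal-surgery`
# (crux `CaptureSuffices`, stmt-FinalStateConjecture-9953, route `PhaseMixingCapture`)

The LEVER of the line, pure genericity logic over `Literature/Geometry/Lorentzian/Genericity.lean`
plus one real-analysis construction. Abstractly in an admissible class `𝓓` and two properties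
`P`, `Q` of initial data: if `Q` is Christodoulou-generic (codimension `1`) in `𝓓`; if through
every `Q ∧ ¬ P` datum of `𝓓` passes a smooth injective admissible THREAD all of whose members
satisfy `Q`; and if every smooth injective admissible curve `F` has a smooth injective admissible
two-parameter UNFOLDING `G ⊇ F` which REPAIRS it (yields `P`) by every small nonzero kick, locally
uniformly near every parameter around which the members of `F` are `Q` — then `P` is
Christodoulou-generic (codimension `1`) in `𝓓`.

## Contents

* `exists_contDiff_support_eq_of_local` — the real-analysis construction (**smooth selector under
  a local positive threshold**): for an open subset `s` of a finite-dimensional real normed space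
  and a relation `R : E → ℝ → Prop` which near every point of `s` is satisfied by all sufficiently
  small positive reals, locally uniformly, there is a `C^∞` function `f : E → [0, 1]` with support
  EXACTLY `s` and `R x (f x)` for every `x ∈ s` — a smooth positive function on `s` squeezed under
  an arbitrary positive locally-bounded-below threshold and extending by zero, with all
  derivatives, across `∂s`. The proof refines Mathlib's `IsOpen.exists_contDiff_support_eq`
  (Gouëzel): `f = ∑ rₙ • gₙ` over a countable family of smooth compactly supported bumps `gₙ`
  covering `s`, each supported where one threshold `εₙ ∈ (0, 1]` is valid, with `rₙ` so small
  that all derivatives of order `≤ n` of `rₙ • gₙ` are `≤ δₙ` (`∑ δₙ < 1`; smoothness by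
  `contDiff_tsum_of_eventually`) AND `rₙ ≤ δₙ ηₙ`, `ηₙ = min_{m ≤ n} εₘ`; at `x ∈ s` with least
  covering index `n₀` this gives `0 < f x ≤ ε_{n₀} ∑ δₙ < ε_{n₀}`.
* `isSmoothDataFamily_comp` — smooth data families are stable under smooth reparametrisation.
* `pointCase` — the `Q d` half: thread + unfolding repaired at `c₀ = 0`, selector
  `θ = (ε/π)·arctan`.
* `stub_diagonalSurgery` — the registered stub. For `d ∈ 𝓓`, `¬ P d`: if `Q d`, `pointCase`; if
  `¬ Q d`, `Q`-genericity gives a curve `F` through `d` whose members `F c`, `c ≠ 0`, are `Q`;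
  unfold it to `G`; near every `c₀ ≠ 0` there is a threshold `ε(c₀) > 0`; the smooth selector on
  the open set `{c ≠ 0}` gives a `C^∞` function `e : ℝ → ℝ` vanishing exactly at `0` with
  `P (G(c, e c))` for all `c ≠ 0`, and the diagonal `K c := G(c, e c)` is the required curve.
-/

-- the doubled `FinalStateConjecture.FinalStateConjecture` path component trips dupNamespace
set_option linter.dupNamespace false

noncomputable section

namespace Summit.FinalStateConjecture.FinalStateConjecture.Theorems.CaptureSuffices.CaptureExportsCensorshipDiagonalSurgery

open Set Filter Function Topology
open scoped Manifold ContDiff Topology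
open Literature.Geometry.Lorentzian

/-! ### The smooth selector (pure real analysis) -/

section Selector

open scoped NNReal

/-- **Smooth selector under a local threshold.** If `s` is open in a finite-dimensional real
normed space and `R y t` holds for all `y` near any given point of `s` and all sufficiently small
`t > 0` (locally uniformly), then some `C^∞` function `f : E → [0, 1]` has support exactly `s` and
satisfies `R x (f x)` at every `x ∈ s`. Refinement of `IsOpen.exists_contDiff_support_eq`. -/
theorem exists_contDiff_support_eq_of_local {E : Type*} [NormedAddCommGroup E]
    [NormedSpace ℝ E] [FiniteDimensional ℝ E] {s : Set E} (hs : IsOpen s) {R : E → ℝ → Prop}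
    (hR : ∀ x ∈ s, ∃ ε : ℝ, 0 < ε ∧ ∀ᶠ y in 𝓝 x, ∀ t : ℝ, 0 < t → t < ε → R y t) :
    ∃ f : E → ℝ, f.support = s ∧ ContDiff ℝ ∞ f ∧ Set.range f ⊆ Set.Icc 0 1 ∧
      ∀ x ∈ s, R x (f x) := by
  rcases eq_empty_or_nonempty s with (rfl | h's)
  · exact ⟨fun _ ↦ 0, Function.support_zero, contDiff_const, by simp, fun x hx ↦ hx.elim⟩
  /- bumps: smooth, compactly supported in `s`, `[0, 1]`-valued, with a threshold `ε ∈ (0, 1]`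
  valid on the whole support -/
  let ι := { f : E → ℝ // f.support ⊆ s ∧ HasCompactSupport f ∧ ContDiff ℝ ∞ f ∧
    range f ⊆ Icc 0 1 ∧ ∃ ε : ℝ, 0 < ε ∧ ε ≤ 1 ∧ ∀ y ∈ f.support, ∀ t : ℝ, 0 < t → t < ε → R y t }
  obtain ⟨T, T_count, hT⟩ : ∃ T : Set ι, T.Countable ∧ ⋃ f ∈ T, support (f : E → ℝ) = s := by
    have : ⋃ f : ι, (f : E → ℝ).support = s := by
      refine Subset.antisymm (iUnion_subset fun f ↦ f.2.1) fun x hx ↦ ?_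
      obtain ⟨ε, hε, hev⟩ := hR x hx
      rcases exists_contDiff_tsupport_subset (n := ⊤) (inter_mem (hs.mem_nhds hx) hev)
        with ⟨f, hf⟩
      have hfs : f.support ⊆ s ∩ {y | ∀ t : ℝ, 0 < t → t < ε → R y t} :=
        (subset_tsupport f).trans hf.1
      let g : ι := ⟨f, hfs.trans inter_subset_left, hf.2.1, hf.2.2.1, hf.2.2.2.1,
        min ε 1, lt_min hε one_pos, min_le_right _ _,
        fun y hy t ht htε ↦ (hfs hy).2 t ht (htε.trans_le (min_le_left _ _))⟩
      have : x ∈ support (g : E → ℝ) := by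
        simp only [g, mem_support, hf.2.2.2.2, Ne, one_ne_zero, not_false_iff]
      exact mem_iUnion_of_mem _ this
    simp_rw [← this]
    apply TopologicalSpace.isOpen_iUnion_countable
    rintro ⟨f, hf⟩
    exact hf.2.2.1.continuous.isOpen_support
  obtain ⟨g0, hg⟩ : ∃ g0 : ℕ → ι, T = range g0 := by
    apply Countable.exists_eq_range T_count
    rcases eq_empty_or_nonempty T with (rfl | hT')
    · simp only [← hT, mem_empty_iff_false, iUnion_of_empty, iUnion_empty,
        Set.not_nonempty_empty] at h's
    · exact hT'
  let g : ℕ → E → ℝ := fun n ↦ (g0 n).1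
  have g_s : ∀ n, support (g n) ⊆ s := fun n ↦ (g0 n).2.1
  have s_g : ∀ x ∈ s, ∃ n, x ∈ support (g n) := fun x hx ↦ by
    rw [← hT] at hx
    obtain ⟨i, iT, hi⟩ : ∃ i ∈ T, x ∈ support (i : E → ℝ) := by
      simpa only [mem_iUnion, exists_prop] using hx
    rw [hg] at iT
    obtain ⟨n, rfl⟩ := iT
    exact ⟨n, hi⟩
  have g_smooth : ∀ n, ContDiff ℝ ∞ (g n) := fun n ↦ (g0 n).2.2.2.1
  have g_comp_supp : ∀ n, HasCompactSupport (g n) := fun n ↦ (g0 n).2.2.1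
  have g_nonneg : ∀ n x, 0 ≤ g n x := fun n x ↦ ((g0 n).2.2.2.2.1 (mem_range_self x)).1
  have g_le_one : ∀ n x, g n x ≤ 1 := fun n x ↦ ((g0 n).2.2.2.2.1 (mem_range_self x)).2
  choose ε hε₀ hε₁ hεR using fun n ↦ (g0 n).2.2.2.2.2
  -- running minimum of the thresholds
  let η : ℕ → ℝ := fun n ↦ (Finset.range (n + 1)).inf' ⟨0, by simp⟩ ε
  have η_pos : ∀ n, 0 < η n := fun n ↦ (Finset.lt_inf'_iff _).2 fun m _ ↦ hε₀ m
  have η_le : ∀ {m n : ℕ}, m ≤ n → η n ≤ ε m := fun {m n} hmn ↦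
    Finset.inf'_le _ (Finset.mem_range.2 (Nat.lt_succ_of_le hmn))
  have η_le_one : ∀ n, η n ≤ 1 := fun n ↦ (η_le le_rfl).trans (hε₁ n)
  obtain ⟨δ, δpos, c, δc, c_lt⟩ :
      ∃ δ : ℕ → ℝ≥0, (∀ i : ℕ, 0 < δ i) ∧ ∃ c : NNReal, HasSum δ c ∧ c < 1 :=
    NNReal.exists_pos_sum_of_countable one_ne_zero ℕ
  have : ∀ n : ℕ, ∃ r : ℝ, 0 < r ∧ r ≤ δ n * η n ∧
      ∀ i ≤ n, ∀ x, ‖iteratedFDeriv ℝ i (r • g n) x‖ ≤ δ n := by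
    intro n
    have : ∀ i, ∃ R, ∀ x, ‖iteratedFDeriv ℝ i (fun x ↦ g n x) x‖ ≤ R := by
      intro i
      have : BddAbove (range fun x ↦ ‖iteratedFDeriv ℝ i (fun x : E ↦ g n x) x‖) := by
        apply ((g_smooth n).continuous_iteratedFDeriv
          (mod_cast le_top)).norm.bddAbove_range_of_hasCompactSupport
        apply HasCompactSupport.comp_left _ norm_zero
        apply (g_comp_supp n).iteratedFDeriv
      rcases this with ⟨R, hR⟩
      exact ⟨R, fun x ↦ hR (mem_range_self _)⟩
    choose R hR using this
    let M := max (((Finset.range (n + 1)).image R).max' (by simp)) 1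
    have δnpos : 0 < (δ n : ℝ) := δpos n
    have IR : ∀ i ≤ n, R i ≤ M := by
      intro i hi
      refine le_trans ?_ (le_max_left _ _)
      apply Finset.le_max'
      apply Finset.mem_image_of_mem
      simp only [Finset.mem_range]
      omega
    have hM1 : 1 ≤ M := le_max_right _ _
    have hM0 : 0 < M := one_pos.trans_le hM1
    have hq : 0 < (δ n : ℝ) * η n := mul_pos δnpos (η_pos n)
    refine ⟨M⁻¹ * (δ n * η n), mul_pos (inv_pos.2 hM0) hq, ?_, fun i hi x ↦ ?_⟩
    · exact mul_le_of_le_one_left hq.le (inv_le_one_of_one_le₀ hM1)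
    calc
      ‖iteratedFDeriv ℝ i ((M⁻¹ * (δ n * η n)) • g n) x‖
          = ‖(M⁻¹ * (δ n * η n)) • iteratedFDeriv ℝ i (g n) x‖ := by
        rw [iteratedFDeriv_const_smul_apply]
        exact (g_smooth n).contDiffAt.of_le (mod_cast le_top)
      _ = M⁻¹ * (δ n * η n) * ‖iteratedFDeriv ℝ i (g n) x‖ := by
        rw [norm_smul _ (iteratedFDeriv ℝ i (g n) x), Real.norm_of_nonneg]
        exact (mul_pos (inv_pos.2 hM0) hq).le
      _ ≤ M⁻¹ * (δ n * η n) * M := by gcongr; exact (hR i x).trans (IR i hi)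
      _ = δ n * η n := by field_simp
      _ ≤ δ n := mul_le_of_le_one_right δnpos.le (η_le_one n)
  choose r rpos hrη hr using this
  have S : ∀ x, Summable fun n ↦ (r n • g n) x := fun x ↦ by
    refine .of_nnnorm_bounded δc.summable fun n ↦ ?_
    rw [← NNReal.coe_le_coe, coe_nnnorm]
    simpa only [norm_iteratedFDeriv_zero] using hr n 0 (Nat.zero_le n) x
  refine ⟨fun x ↦ ∑' n, (r n • g n) x, ?_, ?_, ?_, ?_⟩
  · apply Subset.antisymm
    · intro x hx
      simp only [Pi.smul_apply, smul_eq_mul, mem_support, Ne] at hx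
      contrapose hx
      have : ∀ n, g n x = 0 := by
        intro n
        contrapose! hx
        exact g_s n hx
      simp [this]
    · intro x hx
      obtain ⟨n, hn⟩ : ∃ n, x ∈ support (g n) := s_g x hx
      have I : 0 < r n * g n x := mul_pos (rpos n) (lt_of_le_of_ne (g_nonneg n x) (Ne.symm hn))
      exact ne_of_gt ((S x).tsum_pos (fun i ↦ mul_nonneg (rpos i).le (g_nonneg i x)) n I)
  · refine contDiff_tsum_of_eventually (fun k ↦ (g_smooth k).const_smul (r k))
        (fun k _ ↦ (NNReal.hasSum_coe.2 δc).summable) ?_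
    intro i _
    simp only [Nat.cofinite_eq_atTop, Filter.eventually_atTop]
    exact ⟨i, fun n hn x ↦ hr _ _ hn _⟩
  · rintro - ⟨y, rfl⟩
    refine ⟨tsum_nonneg fun n ↦ mul_nonneg (rpos n).le (g_nonneg n y), le_trans ?_ c_lt.le⟩
    have A : HasSum (fun n ↦ (δ n : ℝ)) c := NNReal.hasSum_coe.2 δc
    simp only [Pi.smul_apply, smul_eq_mul, NNReal.val_eq_coe, ← A.tsum_eq]
    apply Summable.tsum_le_tsum _ (S y) A.summable
    intro n
    apply (le_abs_self _).trans
    simpa only [norm_iteratedFDeriv_zero, Pi.smul_apply, smul_eq_mul, Real.norm_eq_abs] using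
      hr n 0 (Nat.zero_le n) y
  · intro x hx
    classical
    obtain ⟨n₀, hn₀, hmin⟩ : ∃ n₀, x ∈ support (g n₀) ∧ ∀ m < n₀, x ∉ support (g m) :=
      ⟨Nat.find (s_g x hx), Nat.find_spec (s_g x hx), fun m hm ↦ Nat.find_min (s_g x hx) hm⟩
    have A : HasSum (fun n ↦ (δ n : ℝ)) c := NNReal.hasSum_coe.2 δc
    have hle : ∑' n, (r n • g n) x ≤ ε n₀ * c := by
      rw [← A.tsum_eq, ← tsum_mul_left]
      refine Summable.tsum_le_tsum (fun n ↦ ?_) (S x) (A.summable.mul_left _)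
      simp only [Pi.smul_apply, smul_eq_mul]
      rcases Nat.lt_or_ge n n₀ with hn | hn
      · rw [notMem_support.1 (hmin n hn), mul_zero]
        exact mul_nonneg (hε₀ n₀).le (NNReal.coe_nonneg _)
      · calc r n * g n x ≤ r n * 1 := mul_le_mul_of_nonneg_left (g_le_one n x) (rpos n).le
          _ ≤ δ n * η n := by rw [mul_one]; exact hrη n
          _ ≤ δ n * ε n₀ := mul_le_mul_of_nonneg_left (η_le hn) (NNReal.coe_nonneg _)
          _ = ε n₀ * δ n := mul_comm _ _
    have hpos : 0 < ∑' n, (r n • g n) x :=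
      (S x).tsum_pos (fun i ↦ mul_nonneg (rpos i).le (g_nonneg i x)) n₀
        (mul_pos (rpos n₀) (lt_of_le_of_ne (g_nonneg n₀ x) (Ne.symm hn₀)))
    have hc1 : (c : ℝ) < 1 := by exact_mod_cast c_lt
    have hlt : ∑' n, (r n • g n) x < ε n₀ :=
      hle.trans_lt (by simpa using mul_lt_mul_of_pos_left hc1 (hε₀ n₀))
    exact hεR n₀ x hn₀ _ hpos hlt

end Selector

/-! ### Data families: reparametrisation and the point case -/

/-- **Reparametrisation.** If `G` is a jointly smooth `n`-parameter family of initial data and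
`φ : ℝᵐ → ℝⁿ` is smooth, then `G ∘ φ` is a jointly smooth `m`-parameter family (composition of
the two `ContMDiff` clauses of `IsSmoothDataFamily` with the product map `(c, x) ↦ (φ c, x)`). -/
theorem isSmoothDataFamily_comp {X : Type} [TopologicalSpace X] [ChartedSpace E3 X]
    [IsManifold (𝓡 3) ∞ X] {m n : ℕ}
    {G : EuclideanSpace ℝ (Fin n) → InitialDataSet (𝓡 3) X}
    (hG : InitialDataSet.IsSmoothDataFamily n G)
    {φ : EuclideanSpace ℝ (Fin m) → EuclideanSpace ℝ (Fin n)} (hφ : ContDiff ℝ ∞ φ) :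
    InitialDataSet.IsSmoothDataFamily m (G ∘ φ) := by
  have hψ : ContMDiff (𝓘(ℝ, EuclideanSpace ℝ (Fin m)).prod (𝓡 3))
      (𝓘(ℝ, EuclideanSpace ℝ (Fin n)).prod (𝓡 3)) ∞
      (Prod.map φ (id : X → X)) :=
    hφ.contMDiff.prodMap contMDiff_id
  exact ⟨hG.1.comp hψ, hG.2.comp hψ⟩

/-- **Point case.** From a thread `F` through `d = F 0`, an injective admissible smooth unfolding
`G ⊇ F` and a threshold `ε > 0` such that every kick `0 < |e| < ε` of the member `c = 0` yields
`P`, the curve `K e := G(0, θ(e))`, `θ = (ε/π)·arctan`, is a jointly smooth injective admissible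
curve through `d` all of whose other members satisfy `P`. -/
theorem pointCase {X : Type} [TopologicalSpace X] [ChartedSpace E3 X] [IsManifold (𝓡 3) ∞ X]
    {𝓓 : Set (InitialDataSet (𝓡 3) X)} {P : InitialDataSet (𝓡 3) X → Prop}
    {d : InitialDataSet (𝓡 3) X} {F : EuclideanSpace ℝ (Fin 1) → InitialDataSet (𝓡 3) X}
    (h0 : F 0 = d) {G : EuclideanSpace ℝ (Fin 2) → InitialDataSet (𝓡 3) X}
    (hG : InitialDataSet.IsSmoothDataFamily 2 G) (hext : ∀ c : ℝ, G !₂[c, 0] = F !₂[c])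
    (hinj : Function.Injective G) (hadm : ∀ p, G p ∈ 𝓓) {ε : ℝ} (hε : 0 < ε)
    (hrep : ∀ e : ℝ, e ≠ 0 → |e| < ε → P (G !₂[0, e])) :
    ∃ K : EuclideanSpace ℝ (Fin 1) → InitialDataSet (𝓡 3) X,
      InitialDataSet.IsSmoothDataFamily 1 K ∧ K 0 = d ∧ Function.Injective K ∧
        (∀ c, K c ∈ 𝓓) ∧ ∀ c ≠ 0, P (K c) := by
  have hpos : 0 < ε / Real.pi := div_pos hε Real.pi_pos
  set θ : ℝ → ℝ := fun t ↦ ε / Real.pi * Real.arctan t with hθ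
  have hθ0 : θ 0 = 0 := by simp [hθ]
  have hθinj : Function.Injective θ := fun a b hab ↦
    Real.arctan_strictMono.injective (mul_left_cancel₀ hpos.ne' hab)
  have hθne : ∀ t, t ≠ 0 → θ t ≠ 0 := fun t ht h ↦ ht (hθinj (h.trans hθ0.symm))
  have hθlt : ∀ t, |θ t| < ε := by
    intro t
    have h1 : |Real.arctan t| < Real.pi / 2 :=
      abs_lt.2 ⟨Real.neg_pi_div_two_lt_arctan t, Real.arctan_lt_pi_div_two t⟩
    have h2 : |θ t| = ε / Real.pi * |Real.arctan t| := by
      rw [hθ, abs_mul, abs_of_pos hpos]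
    rw [h2]
    calc ε / Real.pi * |Real.arctan t| < ε / Real.pi * (Real.pi / 2) :=
          mul_lt_mul_of_pos_left h1 hpos
      _ = ε / 2 := by field_simp
      _ < ε := by linarith
  set φ : EuclideanSpace ℝ (Fin 1) → EuclideanSpace ℝ (Fin 2) := fun c ↦ !₂[(0 : ℝ), θ (c 0)]
    with hφ
  have hc0 : ContDiff ℝ ∞ (fun c : EuclideanSpace ℝ (Fin 1) ↦ c 0) := contDiff_piLp_apply (p := 2)
  have hφs : ContDiff ℝ ∞ φ := by
    refine contDiff_piLp' (p := 2) fun i ↦ ?_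
    fin_cases i
    · simpa [hφ] using (contDiff_const : ContDiff ℝ ∞ fun _ : EuclideanSpace ℝ (Fin 1) ↦ (0 : ℝ))
    · have h : ContDiff ℝ ∞ (fun c : EuclideanSpace ℝ (Fin 1) ↦ ε / Real.pi * Real.arctan (c 0)) :=
        contDiff_const.mul (Real.contDiff_arctan.comp hc0)
      simpa [hφ, hθ] using h
  have hφ0 : φ 0 = !₂[(0 : ℝ), 0] := by simp [hφ, hθ0]
  have hφ1 : ∀ c : EuclideanSpace ℝ (Fin 1), φ c 1 = θ (c 0) := fun c ↦ by simp [hφ]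
  have hzero : (!₂[(0 : ℝ)] : EuclideanSpace ℝ (Fin 1)) = 0 := by
    ext i; fin_cases i; simp
  refine ⟨G ∘ φ, isSmoothDataFamily_comp hG hφs, ?_, ?_, fun c ↦ hadm _, fun c hc ↦ ?_⟩
  · show G (φ 0) = d
    rw [hφ0, hext 0, hzero, h0]
  · intro a b hab
    have h1 : φ a = φ b := hinj hab
    have h2 : θ (a 0) = θ (b 0) := by rw [← hφ1 a, ← hφ1 b, h1]
    have h3 : a 0 = b 0 := hθinj h2
    ext i; fin_cases i; simpa using h3
  · have hc' : c 0 ≠ 0 := by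
      intro h
      apply hc
      ext i; fin_cases i; simpa using h
    exact hrep _ (hθne _ hc') (hθlt _)

/-- **Diagonal two-parameter surgery** (registered stub `stub_diagonalSurgery`, verbatim the line's
statement `DiagonalSurgery`). If `Q` is Christodoulou-generic with codimension `1` in `𝓓`, if
every `Q ∧ ¬P` datum of `𝓓` lies on a smooth injective admissible thread of `Q` data, and if every
smooth injective admissible curve admits a smooth injective admissible two-parameter unfolding
repairing it (to `P`) by all small nonzero kicks, locally uniformly near every parameter around
which its members are `Q`, then `P` is Christodoulou-generic with codimension `1` in `𝓓`. -/
theorem stub_diagonalSurgery :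
    ∀ (X : Type) [TopologicalSpace X] [ChartedSpace E3 X] [IsManifold (𝓡 3) ∞ X]
      (𝓓 : Set (InitialDataSet (𝓡 3) X)) (P Q : InitialDataSet (𝓡 3) X → Prop),
      InitialDataSet.IsChristodoulouGeneric 𝓓 Q 1 →
      (∀ d ∈ 𝓓, Q d → ¬ P d →
        ∃ F : EuclideanSpace ℝ (Fin 1) → InitialDataSet (𝓡 3) X,
          InitialDataSet.IsSmoothDataFamily 1 F ∧ F 0 = d ∧ Function.Injective F ∧
            (∀ c, F c ∈ 𝓓) ∧ ∀ c, Q (F c)) →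
      (∀ F : EuclideanSpace ℝ (Fin 1) → InitialDataSet (𝓡 3) X,
        InitialDataSet.IsSmoothDataFamily 1 F → Function.Injective F → (∀ c, F c ∈ 𝓓) →
          ∃ G : EuclideanSpace ℝ (Fin 2) → InitialDataSet (𝓡 3) X,
            InitialDataSet.IsSmoothDataFamily 2 G ∧ (∀ c : ℝ, G !₂[c, 0] = F !₂[c]) ∧
              Function.Injective G ∧ (∀ p, G p ∈ 𝓓) ∧
                ∀ c₀ : ℝ, (∀ᶠ c in 𝓝 c₀, Q (F !₂[c])) →
                  ∃ ε > (0 : ℝ), ∀ᶠ c in 𝓝 c₀, ∀ e : ℝ, e ≠ 0 → |e| < ε → P (G !₂[c, e])) →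
      InitialDataSet.IsChristodoulouGeneric 𝓓 P 1 := by
  intro X _ _ _ 𝓓 P Q hQ hthread hrepair d hd
  obtain ⟨hd𝓓, hnP⟩ := hd
  by_cases hQd : Q d
  · -- point case: repair the thread through `d` at the parameter `0`
    obtain ⟨F, hF, hF0, hFinj, hFadm, hFQ⟩ := hthread d hd𝓓 hQd hnP
    obtain ⟨G, hG, hext, hGinj, hGadm, hloc⟩ := hrepair F hF hFinj hFadm
    obtain ⟨ε, hε, hev⟩ := hloc 0 (Eventually.of_forall fun c ↦ hFQ _)
    obtain ⟨K, hK, hK0, hKinj, hKadm, hKP⟩ :=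
      pointCase (P := P) hF0 hG hext hGinj hGadm hε fun e he hlt ↦ hev.self_of_nhds e he hlt
    exact ⟨K, hK, hK0, hKinj, hKadm, fun c hc hmem ↦ hmem.2 (hKP c hc)⟩
  · -- curve case: diagonal surgery along the `Q`-curve through `d` with a flat selector
    obtain ⟨F, hF, hF0, hFinj, hFadm, hFexc⟩ := hQ d ⟨hd𝓓, hQd⟩
    have hFQ : ∀ c ≠ 0, Q (F c) := fun c hc ↦ by
      by_contra h
      exact hFexc c hc ⟨hFadm c, h⟩
    obtain ⟨G, hG, hext, hGinj, hGadm, hloc⟩ := hrepair F hF hFinj hFadm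
    have hne1 : ∀ c : ℝ, c ≠ 0 → (!₂[c] : EuclideanSpace ℝ (Fin 1)) ≠ 0 := by
      intro c hc h
      apply hc
      simpa using congrArg (fun v : EuclideanSpace ℝ (Fin 1) ↦ v 0) h
    have hR : ∀ c₀ ∈ {c : ℝ | c ≠ 0}, ∃ ε : ℝ, 0 < ε ∧
        ∀ᶠ c in 𝓝 c₀, ∀ t : ℝ, 0 < t → t < ε → P (G !₂[c, t]) := by
      intro c₀ hc₀
      have hev : ∀ᶠ c in 𝓝 c₀, Q (F !₂[c]) :=
        (eventually_ne_nhds hc₀).mono fun c hc ↦ hFQ _ (hne1 c hc)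
      obtain ⟨ε, hε, hev'⟩ := hloc c₀ hev
      exact ⟨ε, hε, hev'.mono fun c hc t ht htε ↦ hc t ht.ne' (by rwa [abs_of_pos ht])⟩
    obtain ⟨e, hesupp, hesmooth, -, heP⟩ := exists_contDiff_support_eq_of_local isOpen_ne hR
    have he0 : e 0 = 0 := by
      have : (0 : ℝ) ∉ e.support := by rw [hesupp]; simp
      exact notMem_support.1 this
    -- the diagonal curve `c ↦ G(c, e c)`
    set φ : EuclideanSpace ℝ (Fin 1) → EuclideanSpace ℝ (Fin 2) := fun c ↦ !₂[c 0, e (c 0)]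
      with hφ
    have hc0 : ContDiff ℝ ∞ (fun c : EuclideanSpace ℝ (Fin 1) ↦ c 0) :=
      contDiff_piLp_apply (p := 2)
    have hφs : ContDiff ℝ ∞ φ := by
      refine contDiff_piLp' (p := 2) fun i ↦ ?_
      fin_cases i
      · simpa [hφ] using hc0
      · simpa [hφ, Function.comp_def] using hesmooth.comp hc0
    have hφ0 : ∀ c : EuclideanSpace ℝ (Fin 1), φ c 0 = c 0 := fun c ↦ by simp [hφ]
    have hzero : (!₂[(0 : ℝ)] : EuclideanSpace ℝ (Fin 1)) = 0 := by
      ext i; fin_cases i; simp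
    refine ⟨G ∘ φ, isSmoothDataFamily_comp hG hφs, ?_, ?_, fun c ↦ hGadm _, fun c hc hmem ↦ ?_⟩
    · show G (φ 0) = d
      have : φ 0 = !₂[(0 : ℝ), 0] := by simp [hφ, he0]
      rw [this, hext 0, hzero, hF0]
    · intro a b hab
      have h1 : φ a = φ b := hGinj hab
      have h3 : a 0 = b 0 := by rw [← hφ0 a, ← hφ0 b, h1]
      ext i; fin_cases i; simpa using h3
    · have hc' : c 0 ≠ 0 := by
        intro h
        apply hc
        ext i; fin_cases i; simpa using h
      exact hmem.2 (heP (c 0) hc')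

end Summit.FinalStateConjecture.FinalStateConjecture.Theorems.CaptureSuffices.CaptureExportsCensorshipDiagonalSurgery

end
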